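import Mathlib.Geometry.Manifold.ContMDiffMap
import Mathlib.Topology.Homotopy.Basic
import Mathlib.Analysis.Calculus.FDeriv.Const
import Summits.Ventures.HodgeRepro2.HostAPI.Carriers.NumberTheory.Transcendental.FormsAlgebra
import Summits.Ventures.HodgeRepro2.HostAPI.Carriers.NumberTheory.Transcendental.FormIntegration
import Summits.Ventures.HodgeRepro2.HostAPI.Carriers.NumberTheory.Transcendental.ComplexForms
import Summits.Ventures.HodgeRepro2.HostAPI.Carriers.AlgebraicTopology.SingularHomology.SingularCochains
import Summits.Ventures.HodgeRepro2.HostAPI.Carriers.AlgebraicTopology.SingularHomology.CupProduct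
import Summits.Ventures.HodgeRepro2.HostAPI.Carriers.AlgebraicTopology.SingularHomology.PoincareDuality
import Summits.Ventures.HodgeRepro2.HostAPI.Util.ForallBinderLint
open HostAPI.Carriers

noncomputable section

open scoped Manifold ContDiff Topology
open Set

universe u

namespace HostAPI.Carriers.NumberTheory.Transcendental

section Const

variable {E : Type*} [NormedAddCommGroup E] [NormedSpace ℝ E]
  {H : Type*} [TopologicalSpace H] {I : ModelWithCorners ℝ E H}
  {M : Type*} [TopologicalSpace M] [ChartedSpace H M]
  {F : Type*} [NormedAddCommGroup F] [NormedSpace ℝ F]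
  {A : Type*} [NormedCommRing A] [NormedAlgebra ℝ A]

section MForm
open HostAPI.Carriers.Geometry.Kaehler (MForm)
open HostAPI.Carriers.Geometry.Kaehler.MForm

variable (I M) in

def _root_.HostAPI.Carriers.Geometry.Kaehler.MForm.const (a : F) : MForm I M F 0 := fun _ ↦
  ContinuousAlternatingMap.constOfIsEmpty ℝ E (Fin 0) a

@[simp]
theorem _root_.HostAPI.Carriers.Geometry.Kaehler.MForm.const_apply (a : F) (x : M) (v : Fin 0 → TangentSpace I x) : const I M a x v = a :=
  rfl

theorem _root_.HostAPI.Carriers.Geometry.Kaehler.MForm.inChart_const (a : F) (x₀ : M) :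
    (const I M a).inChart x₀ = fun _ ↦ ContinuousAlternatingMap.constOfIsEmpty ℝ E (Fin 0) a := by
  funext y
  ext v
  rfl

end MForm

theorem isSmoothForm_const (a : F) : HostAPI.Carriers.Geometry.Kaehler.IsSmoothForm (HostAPI.Carriers.Geometry.Kaehler.MForm.const I M a) := fun x ↦ by
  rw [HostAPI.Carriers.Geometry.Kaehler.MForm.inChart_const]
  exact contDiffWithinAt_const

theorem mextDeriv_const (a : F) : HostAPI.Carriers.Geometry.Kaehler.mextDeriv (HostAPI.Carriers.Geometry.Kaehler.MForm.const I M a) = 0 := by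
  funext x
  have h : extDerivWithin (fun _ : E ↦ ContinuousAlternatingMap.constOfIsEmpty ℝ E (Fin 0) a)
      (range I) (extChartAt I x x) = 0 := by
    rw [extDerivWithin, fderivWithin_const_apply,
      ← ContinuousAlternatingMap.alternatizeUncurryFinCLM_apply, map_zero]
  simp only [HostAPI.Carriers.Geometry.Kaehler.mextDeriv, HostAPI.Carriers.Geometry.Kaehler.MForm.inChart_const, h]
  ext v
  rfl

theorem const_mem_closedSmoothForms (a : F) : HostAPI.Carriers.Geometry.Kaehler.MForm.const I M a ∈ HostAPI.Carriers.Geometry.Kaehler.closedSmoothForms I M F 0 :=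
  ⟨isSmoothForm_const a, mextDeriv_const a⟩

variable (I M A) in

def _root_.HostAPI.Carriers.Geometry.Kaehler.deRhamCohomology.one : HostAPI.Carriers.Geometry.Kaehler.deRhamCohomology I M A 0 :=
  HostAPI.Carriers.Geometry.Kaehler.deRhamCohomology.mk ⟨HostAPI.Carriers.Geometry.Kaehler.MForm.const I M (1 : A), const_mem_closedSmoothForms 1⟩

@[simp]
theorem _root_.HostAPI.Carriers.Geometry.Kaehler.MForm.pullback_const {E' : Type*} [NormedAddCommGroup E'] [NormedSpace ℝ E']
    {H' : Type*} [TopologicalSpace H'] {I' : ModelWithCorners ℝ E' H'}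
    {N : Type*} [TopologicalSpace N] [ChartedSpace H' N] (f : M → N) (a : F) :
    (HostAPI.Carriers.Geometry.Kaehler.MForm.const I' N a).pullback I f = HostAPI.Carriers.Geometry.Kaehler.MForm.const I M a := by
  funext x
  ext v
  rfl

end Const

section Homotopy

variable {E : Type*} [NormedAddCommGroup E] [NormedSpace ℝ E]
  {H : Type*} [TopologicalSpace H] {I : ModelWithCorners ℝ E H}
  {M : Type*} [TopologicalSpace M] [ChartedSpace H M] [IsManifold I ∞ M]
  {E' : Type*} [NormedAddCommGroup E'] [NormedSpace ℝ E']
  {H' : Type*} [TopologicalSpace H'] {I' : ModelWithCorners ℝ E' H'}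
  {N : Type*} [TopologicalSpace N] [ChartedSpace H' N] [IsManifold I' ∞ N]
  {F : Type*} [NormedAddCommGroup F] [NormedSpace ℝ F]

variable (I M I' N F) in

def _root_.HostAPI.Carriers.Geometry.Kaehler.deRhamCohomology.map_eq_of_homotopic [CompleteSpace F] [PullbackFacts I M I' N F] : Prop :=
  ∀ {f g : M → N} (hf : ContMDiff I I' ∞ f) (hg : ContMDiff I I' ∞ g) (Φ : ℝ × M → N),
    ContMDiff (𝓘(ℝ, ℝ).prod I) I' ∞ Φ → (∀ x, Φ (0, x) = f x) → (∀ x, Φ (1, x) = g x) →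
    ∀ k : ℕ,
    (HostAPI.Carriers.Geometry.Kaehler.deRhamCohomology.map hf k : HostAPI.Carriers.Geometry.Kaehler.deRhamCohomology I' N F k →ₗ[ℝ] HostAPI.Carriers.Geometry.Kaehler.deRhamCohomology I M F k) =
      HostAPI.Carriers.Geometry.Kaehler.deRhamCohomology.map hg k

end Homotopy

section Family

variable {E : Type u} [NormedAddCommGroup E] [NormedSpace ℝ E]
  {H : Type u} [TopologicalSpace H] (I : ModelWithCorners ℝ E H)

def DeRhamIsoFamily : Type (u + 1) :=
  ∀ (M : Type u) [TopologicalSpace M] [ChartedSpace H M] [IsManifold I ∞ M] [T2Space M]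
    [SigmaCompactSpace M] (k : ℕ),
    HostAPI.Carriers.Geometry.Kaehler.deRhamCohomology I M ℝ k ≃ₗ[ℝ] HostAPI.Carriers.AlgebraicTopology.SingularHomology.singularCohomology ℝ ℝ M k

namespace DeRhamIsoFamily

variable {I}

def IsNatural (e : DeRhamIsoFamily I) : Prop :=
  ∀ (M N : Type u) [TopologicalSpace M] [ChartedSpace H M] [IsManifold I ∞ M] [T2Space M]
    [SigmaCompactSpace M] [TopologicalSpace N] [ChartedSpace H N] [IsManifold I ∞ N] [T2Space N]
    [SigmaCompactSpace N] [PullbackFacts I M I N ℝ] (f : M → N) (hf : ContMDiff I I ∞ f) (k : ℕ)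
    (c : HostAPI.Carriers.Geometry.Kaehler.deRhamCohomology I N ℝ k),
    e M k (HostAPI.Carriers.Geometry.Kaehler.deRhamCohomology.map hf k c) =
      HostAPI.Carriers.AlgebraicTopology.SingularHomology.singularCohomology.map ℝ ℝ ⟨f, hf.continuous⟩ k (e N k c)

def IsMultiplicative (e : DeRhamIsoFamily I) : Prop :=
  ∀ (M : Type u) [TopologicalSpace M] [ChartedSpace H M] [IsManifold I ∞ M] [T2Space M]
    [SigmaCompactSpace M] [WedgeFacts I M ℝ] (k l m : ℕ) (h : k + l = m)
    (a : HostAPI.Carriers.Geometry.Kaehler.deRhamCohomology I M ℝ k) (b : HostAPI.Carriers.Geometry.Kaehler.deRhamCohomology I M ℝ l),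
    e M m (HostAPI.Carriers.Geometry.Kaehler.deRhamCohomology.cup h a b) = HostAPI.Carriers.AlgebraicTopology.SingularHomology.cupProduct h (e M k a) (e M l b)

def IsNormalized (e : DeRhamIsoFamily I) : Prop :=
  ∀ (M : Type u) [TopologicalSpace M] [ChartedSpace H M] [IsManifold I ∞ M] [T2Space M]
    [SigmaCompactSpace M],
    e M 0 (HostAPI.Carriers.Geometry.Kaehler.deRhamCohomology.one I M ℝ) = HostAPI.Carriers.AlgebraicTopology.SingularHomology.singularCohomology.one ℝ M

theorem apply_map_id (e : DeRhamIsoFamily I) (M : Type u)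
    [TopologicalSpace M] [ChartedSpace H M] [IsManifold I ∞ M] [T2Space M] [SigmaCompactSpace M]
    [PullbackFacts I M I M ℝ] (k : ℕ) (c : HostAPI.Carriers.Geometry.Kaehler.deRhamCohomology I M ℝ k) :
    e M k (HostAPI.Carriers.Geometry.Kaehler.deRhamCohomology.map (contMDiff_id : ContMDiff I I ∞ (id : M → M)) k c) =
      HostAPI.Carriers.AlgebraicTopology.SingularHomology.singularCohomology.map ℝ ℝ (ContinuousMap.id M) k (e M k c) := by
  rw [HostAPI.Carriers.Geometry.Kaehler.deRhamCohomology.map_id, HostAPI.Carriers.AlgebraicTopology.SingularHomology.singularCohomology.map_id]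
  rfl

theorem IsMultiplicative.map_cup_one {e : DeRhamIsoFamily I} (he : e.IsMultiplicative)
    (he₁ : e.IsNormalized) (M : Type u) [TopologicalSpace M] [ChartedSpace H M]
    [IsManifold I ∞ M] [T2Space M] [SigmaCompactSpace M] [WedgeFacts I M ℝ] (l : ℕ)
    (b : HostAPI.Carriers.Geometry.Kaehler.deRhamCohomology I M ℝ l) :
    e M l (HostAPI.Carriers.Geometry.Kaehler.deRhamCohomology.cup (Nat.zero_add l) (HostAPI.Carriers.Geometry.Kaehler.deRhamCohomology.one I M ℝ) b) = e M l b := by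
  rw [he, he₁, HostAPI.Carriers.AlgebraicTopology.SingularHomology.one_cupProduct]

end DeRhamIsoFamily

def exists_deRhamIsoFamily [FiniteDimensional ℝ E] : Prop :=
  ∃ e : DeRhamIsoFamily I, e.IsNatural ∧ e.IsMultiplicative ∧ e.IsNormalized

end Family

section Compact

variable {E : Type*} [NormedAddCommGroup E] [NormedSpace ℝ E]
  {H : Type*} [TopologicalSpace H] (I : ModelWithCorners ℝ E H)

def finite_deRhamCohomology_of_compactSpace [FiniteDimensional ℝ E] (M : Type*)
    [TopologicalSpace M] [ChartedSpace H M] [IsManifold I ∞ M] [T2Space M] [CompactSpace M]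
    (k : ℕ) : Prop :=
  Module.Finite ℝ (HostAPI.Carriers.Geometry.Kaehler.deRhamCohomology I M ℝ k)

def finrank_deRhamCohomology_eq_bettiNumber [FiniteDimensional ℝ E] (M : Type*)
    [TopologicalSpace M] [ChartedSpace H M] [IsManifold I ∞ M] [T2Space M] [CompactSpace M]
    (k : ℕ) : Prop :=
  Module.finrank ℝ (HostAPI.Carriers.Geometry.Kaehler.deRhamCohomology I M ℝ k) = HostAPI.Carriers.AlgebraicTopology.SingularHomology.bettiNumber ℝ M k

end Compact

section ComplexMap

variable {E : Type*} [NormedAddCommGroup E] [NormedSpace ℂ E]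
  {M : Type*} [TopologicalSpace M] [ChartedSpace E M]
  {E' : Type*} [NormedAddCommGroup E'] [NormedSpace ℂ E']
  {N : Type*} [TopologicalSpace N] [ChartedSpace E' N] {k : ℕ}

variable (E) in

def _root_.HostAPI.Carriers.Geometry.Kaehler.MForm.cpullbackₗ (f : M → N) (k : ℕ) : HostAPI.Carriers.Geometry.Kaehler.MForm 𝓘(ℝ, E') N ℂ k →ₗ[ℂ] HostAPI.Carriers.Geometry.Kaehler.MForm 𝓘(ℝ, E) M ℂ k where
  toFun β := β.pullback 𝓘(ℝ, E) f
  map_add' _ _ := rfl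
  map_smul' _ _ := rfl

@[simp]
theorem _root_.HostAPI.Carriers.Geometry.Kaehler.MForm.cpullbackₗ_apply (f : M → N) (β : HostAPI.Carriers.Geometry.Kaehler.MForm 𝓘(ℝ, E') N ℂ k) :
    HostAPI.Carriers.Geometry.Kaehler.MForm.cpullbackₗ E f k β = β.pullback 𝓘(ℝ, E) f :=
  rfl

variable [IsManifold 𝓘(ℝ, E) ∞ M] [IsManifold 𝓘(ℝ, E') ∞ N] [PullbackFacts 𝓘(ℝ, E) M 𝓘(ℝ, E') N ℂ]

theorem pullback_mem_csmoothForms {f : M → N} (hf : ContMDiff 𝓘(ℝ, E) 𝓘(ℝ, E') ∞ f)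
    {β : HostAPI.Carriers.Geometry.Kaehler.MForm 𝓘(ℝ, E') N ℂ k} (hβ : β ∈ csmoothForms E' N k) :
    β.pullback 𝓘(ℝ, E) f ∈ csmoothForms E M k := by
  rw [mem_csmoothForms_iff] at hβ ⊢
  exact isSmoothForm_pullback hf hβ

theorem pullback_mem_cclosedSmoothForms {f : M → N} (hf : ContMDiff 𝓘(ℝ, E) 𝓘(ℝ, E') ∞ f)
    {β : HostAPI.Carriers.Geometry.Kaehler.MForm 𝓘(ℝ, E') N ℂ k} (hβ : β ∈ cclosedSmoothForms E' N k) :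
    β.pullback 𝓘(ℝ, E) f ∈ cclosedSmoothForms E M k := by
  have h : (cclosedSmoothForms E' N k).map (HostAPI.Carriers.Geometry.Kaehler.MForm.cpullbackₗ E f k) ≤ cclosedSmoothForms E M k :=
    (Submodule.map_span_le _ _ _).2 fun γ hγ ↦
      Submodule.subset_span (pullback_mem_closedSmoothForms hf hγ)
  exact h (Submodule.mem_map_of_mem hβ)

theorem pullback_mem_cexactSmoothForms {f : M → N} (hf : ContMDiff 𝓘(ℝ, E) 𝓘(ℝ, E') ∞ f)
    {β : HostAPI.Carriers.Geometry.Kaehler.MForm 𝓘(ℝ, E') N ℂ k} (hβ : β ∈ cexactSmoothForms E' N k) :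
    β.pullback 𝓘(ℝ, E) f ∈ cexactSmoothForms E M k := by
  cases k with
  | zero =>
    have h0 : β = 0 := (Submodule.mem_bot ℂ).1 hβ
    subst h0
    exact Submodule.zero_mem _
  | succ k =>
    have h : (cexactSmoothForms E' N (k + 1)).map (HostAPI.Carriers.Geometry.Kaehler.MForm.cpullbackₗ E f (k + 1)) ≤
        cexactSmoothForms E M (k + 1) := by
      refine (Submodule.map_span_le _ _ _).2 ?_
      rintro _ ⟨γ, hγ, rfl⟩
      have hγs : HostAPI.Carriers.Geometry.Kaehler.IsSmoothForm γ := (mem_csmoothForms_iff γ).1 hγ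
      refine Submodule.subset_span ⟨γ.pullback 𝓘(ℝ, E) f, ?_, ?_⟩
      · exact (mem_csmoothForms_iff _).2 (isSmoothForm_pullback hf hγs)
      · exact mextDeriv_pullback hf hγs
    exact h (Submodule.mem_map_of_mem hβ)

variable (E) in

def complexDeRhamCohomology.map {f : M → N} (hf : ContMDiff 𝓘(ℝ, E) 𝓘(ℝ, E') ∞ f) (k : ℕ) :
    complexDeRhamCohomology E' N k →ₗ[ℂ] complexDeRhamCohomology E M k :=
  Submodule.mapQ _ _
    ((HostAPI.Carriers.Geometry.Kaehler.MForm.cpullbackₗ E f k).restrict fun _ hβ ↦ pullback_mem_cclosedSmoothForms hf hβ)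
    fun _ hβ ↦ pullback_mem_cexactSmoothForms hf hβ

theorem complexDeRhamCohomology.map_mk {f : M → N} (hf : ContMDiff 𝓘(ℝ, E) 𝓘(ℝ, E') ∞ f)
    (β : cclosedSmoothForms E' N k) :
    complexDeRhamCohomology.map E hf k (complexDeRhamCohomology.mk E' N k β) =
      complexDeRhamCohomology.mk E M k
        ⟨(β : HostAPI.Carriers.Geometry.Kaehler.MForm 𝓘(ℝ, E') N ℂ k).pullback 𝓘(ℝ, E) f, pullback_mem_cclosedSmoothForms hf β.2⟩ :=
  rfl

theorem complexDeRhamCohomology.map_id [PullbackFacts 𝓘(ℝ, E) M 𝓘(ℝ, E) M ℂ] (k : ℕ) :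
    complexDeRhamCohomology.map E (contMDiff_id : ContMDiff 𝓘(ℝ, E) 𝓘(ℝ, E) ∞ (id : M → M)) k =
      LinearMap.id := by
  refine Submodule.linearMap_qext _ (LinearMap.ext fun β ↦ ?_)
  change complexDeRhamCohomology.map E contMDiff_id k (complexDeRhamCohomology.mk E M k β) =
    complexDeRhamCohomology.mk E M k β
  rw [complexDeRhamCohomology.map_mk]
  congr 1
  exact Subtype.ext (HostAPI.Carriers.Geometry.Kaehler.MForm.pullback_id _)

end ComplexMap

section ComplexFamily

variable (E : Type u) [NormedAddCommGroup E] [NormedSpace ℂ E]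

def ComplexDeRhamIsoFamily : Type (u + 1) :=
  ∀ (M : Type u) [TopologicalSpace M] [ChartedSpace E M] [IsManifold 𝓘(ℝ, E) ∞ M] [T2Space M]
    [SigmaCompactSpace M] (k : ℕ),
    complexDeRhamCohomology E M k ≃ₗ[ℂ] HostAPI.Carriers.AlgebraicTopology.SingularHomology.singularCohomology ℂ ℂ M k

namespace ComplexDeRhamIsoFamily

variable {E}

def IsNatural (e : ComplexDeRhamIsoFamily E) : Prop :=
  ∀ (M N : Type u) [TopologicalSpace M] [ChartedSpace E M] [IsManifold 𝓘(ℝ, E) ∞ M] [T2Space M]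
    [SigmaCompactSpace M] [TopologicalSpace N] [ChartedSpace E N] [IsManifold 𝓘(ℝ, E) ∞ N]
    [T2Space N] [SigmaCompactSpace N] [PullbackFacts 𝓘(ℝ, E) M 𝓘(ℝ, E) N ℂ] (f : M → N)
    (hf : ContMDiff 𝓘(ℝ, E) 𝓘(ℝ, E) ∞ f) (k : ℕ) (c : complexDeRhamCohomology E N k),
    e M k (complexDeRhamCohomology.map E hf k c) =
      HostAPI.Carriers.AlgebraicTopology.SingularHomology.singularCohomology.map ℂ ℂ ⟨f, hf.continuous⟩ k (e N k c)

end ComplexDeRhamIsoFamily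

def exists_complexDeRhamIsoFamily [FiniteDimensional ℂ E] : Prop :=
  ∃ e : ComplexDeRhamIsoFamily E, e.IsNatural

def finrank_complexDeRham_eq_bettiNumber [FiniteDimensional ℂ E] (M : Type*)
    [TopologicalSpace M] [ChartedSpace E M] [IsManifold 𝓘(ℝ, E) ∞ M] [T2Space M]
    [CompactSpace M] (k : ℕ) : Prop :=
  Module.finrank ℂ (complexDeRhamCohomology E M k) = HostAPI.Carriers.AlgebraicTopology.SingularHomology.bettiNumber ℂ M k

end ComplexFamily

end HostAPI.Carriers.NumberTheory.Transcendental
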